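import Mathlib.Analysis.SpecialFunctions.Pow.Real

/-!
# `BetaCancellation` (stmt-KontsevichZagierPeriods-13633) — line `dirichlet-companion-to-pi`: the two charts

drefute (refuter) calibration, companion of `DirichletCompanionStubs.lean`: symbol-for-symbol
bookkeeping of the two rule-(2) moves of the lead's reshaped skeleton (2026-08-16T02:03Z).
The simplex integrand `u^{ℓ-1} v^{m-1} (1-u-v)^{-m}` of `S` pulls back along the polar chart
`Φ(x,y) = (xy, x(1-y))` (`|det Φ'| = x`) EXACTLY to the integrand of `P` (`pullback_polar`) and
along the linear chart `Ψ(t,u) = (u, (1-u)t)` (`|det Ψ'| = 1-u`) EXACTLY to the integrand of `B`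
(`pullback_linear`); both charts are bijections of the open box onto the open simplex
(`polar_inverse`, `linear_inverse`).  Hence `value S = value P = value B` (Dirichlet's formula,
Andrews–Askey–Roy Thm 1.8.1) and `stub_dirichletPolar`, `stub_dirichletLinear` are consequences of
the summit like the other stubs of the line: no stub-false finding is possible; the identities are
the `rw` lemmas a prover of the two stubs needs.  Sorry-free, no axioms beyond Mathlib's.
-/

noncomputable section

set_option linter.dupNamespace false

namespace Summit.KontsevichZagierPeriods.KontsevichZagierPeriods.BetaCancellationNegative

/-- POLAR chart `Φ(x,y) = (xy, x(1-y))`, `|det Φ'| = x`: the simplex integrand of `S` pulled back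
along `Φ` and multiplied by the Jacobian is EXACTLY the integrand of `P`. [folklore] -/
theorem pullback_polar (ℓ m : ℝ) {x y : ℝ} (hx : 0 < x) (hy : 0 < y) (hy1 : y < 1) :
    (x * y) ^ (ℓ - 1) * (x * (1 - y)) ^ (m - 1) * (1 - x * y - x * (1 - y)) ^ (-m) * x =
      x ^ (ℓ + m - 1) * (1 - x) ^ (-m) * (y ^ (ℓ - 1) * (1 - y) ^ (m - 1)) := by
  have h1y : 0 < 1 - y := by linarith
  have e : 1 - x * y - x * (1 - y) = 1 - x := by ring
  rw [e, Real.mul_rpow hx.le hy.le, Real.mul_rpow hx.le h1y.le]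
  have hx' : x ^ (ℓ + m - 1) = x ^ (ℓ - 1) * x ^ (m - 1) * x := by
    rw [← Real.rpow_add hx, ← Real.rpow_add_one hx.ne']
    congr 1; ring
  rw [hx']
  ring

/-- LINEAR chart `Ψ(t,u) = (u, (1-u)t)`, `|det Ψ'| = 1 - u`: the simplex integrand of `S` pulled
back along `Ψ` and multiplied by the Jacobian is EXACTLY the integrand of `B`. [folklore] -/
theorem pullback_linear (ℓ m : ℝ) {t u : ℝ} (ht : 0 < t) (ht1 : t < 1) (hu1 : u < 1) :
    u ^ (ℓ - 1) * ((1 - u) * t) ^ (m - 1) * (1 - u - (1 - u) * t) ^ (-m) * (1 - u) =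
      t ^ (m - 1) * (1 - t) ^ (-m) * u ^ (ℓ - 1) := by
  have h1u : 0 < 1 - u := by linarith
  have h1t : 0 < 1 - t := by linarith
  have e : 1 - u - (1 - u) * t = (1 - u) * (1 - t) := by ring
  rw [e, Real.mul_rpow h1u.le ht.le, Real.mul_rpow h1u.le h1t.le]
  have hu' : (1 - u) ^ (m - 1) * (1 - u) ^ (-m) * (1 - u) = 1 := by
    rw [← Real.rpow_add h1u, ← Real.rpow_add_one h1u.ne']
    have : m - 1 + -m + 1 = 0 := by ring
    rw [this, Real.rpow_zero]
  calc u ^ (ℓ - 1) * ((1 - u) ^ (m - 1) * t ^ (m - 1)) * ((1 - u) ^ (-m) * (1 - t) ^ (-m)) * (1 - u)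
      = ((1 - u) ^ (m - 1) * (1 - u) ^ (-m) * (1 - u)) * (t ^ (m - 1) * (1 - t) ^ (-m) * u ^ (ℓ - 1)) := by
        ring
    _ = t ^ (m - 1) * (1 - t) ^ (-m) * u ^ (ℓ - 1) := by rw [hu', one_mul]

/-- The polar chart is a bijection of the open box onto the open simplex: explicit inverse
`x = u + v`, `y = u / (u + v)`. [folklore] -/
theorem polar_inverse {u v : ℝ} (hu : 0 < u) (hv : 0 < v) (huv : u + v < 1) :
    let x := u + v
    let y := u / (u + v)
    (0 < x ∧ x < 1) ∧ (0 < y ∧ y < 1) ∧ x * y = u ∧ x * (1 - y) = v := by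
  have hx : 0 < u + v := by linarith
  refine ⟨⟨hx, huv⟩, ⟨div_pos hu hx, (div_lt_one hx).2 (by linarith)⟩, ?_, ?_⟩
  · field_simp
  · field_simp
    ring

/-- The linear chart is a bijection of the open box onto the open simplex: explicit inverse
`u = z₀`, `t = z₁ / (1 - z₀)`. [folklore] -/
theorem linear_inverse {a b : ℝ} (ha : 0 < a) (hb : 0 < b) (hab : a + b < 1) :
    let u := a
    let t := b / (1 - a)
    (0 < t ∧ t < 1) ∧ (0 < u ∧ u < 1) ∧ (1 - u) * t = b := by
  have h1a : 0 < 1 - a := by linarith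
  refine ⟨⟨div_pos hb h1a, (div_lt_one h1a).2 (by linarith)⟩, ⟨ha, by linarith⟩, ?_⟩
  field_simp

end Summit.KontsevichZagierPeriods.KontsevichZagierPeriods.BetaCancellationNegative
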